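import Literature.MathematicalPhysics.QuantumManyBody.BogoliubovQuarticBounds
import HarnessLib

/-!
# The particle number in the Bogoliubov–Weyl trial state: `⟨𝒩⟩ ≥ N₀ + ∑σ²` exactly, `⟨𝒩²⟩ ≤ KN²`

Topic `Literature/MathematicalPhysics/QuantumManyBody`, namespace `BoseGas.Fock`; theorem-only (Prop. 2.4
of [BastiCenatiempoSchlein2021] in the form needed by the provefact
`Literature.MathematicalPhysics.QuantumManyBody.BoseGas.BastiCenatiempoSchlein2021_upperBound`).

For the conjugated annihilators `A_q = conjAn = γ_qa_q + σ_qa†_{σq} + √N₀[q=z]` and a vector `ξ`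
graded by a constant weight (`2g, 4g ≠ 0`) with `a_zξ = 0`:

* `sum_fockInner_conjAn_self_re_eq` — `∑_q‖A_qξ‖² = (N₀ + ∑_qσ_q²)‖ξ‖² + ∑_q(γ_q²+σ_q²)‖a_qξ‖²`; in
  particular `⟨𝒩⟩ ≥ N₀ + ‖σ‖²` (`= N` with the choice `N₀ = N - ‖σ_L‖²` of [ibid., (eq:fixN0)]);
* `sum_sum_fockInner_conjAn_conjAn_self_re_le` — `∑_{p,q}‖A_pA_qξ‖²` is bounded by an explicit
  polynomial in `N₀`, `∑σ²`, `sup|σ|`, `sup|γ|`, `∑‖a_qξ‖²`, `∑‖a_pa_qξ‖²` and `‖ξ‖²` — the crude form of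
  `⟨𝒩²⟩ ≤ CN²` [ibid., Prop. 2.4].

## References

* [BastiCenatiempoSchlein2021] G. Basti, S. Cenatiempo, B. Schlein, Forum Math. Sigma 9 (2021) e74,
  arXiv:2101.06222: Prop. 2.4, (2.14), (eq:fixN0).
-/

noncomputable section

namespace Literature.MathematicalPhysics.QuantumManyBody.BoseGas

open Complex MvPolynomial Finset
open scoped ComplexConjugate BigOperators

namespace Fock

variable {ι : Type*} [Fintype ι] [DecidableEq ι] {z : ι} {σ : ι → ι} {P : Finset ι} {N₀ : ℝ} {t : ι → ℝ}

omit [Fintype ι] [DecidableEq ι] in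
/-- `‖u + v‖² ≤ 2‖u‖² + 2‖v‖²`. [folklore] -/
theorem fockInner_add_self_re_le (u v : MvPolynomial ι ℂ) :
    (fockInner (u + v) (u + v)).re ≤ 2 * (fockInner u u).re + 2 * (fockInner v v).re := by
  have h := norm_fockInner_le_add_half u v
  have hre : (fockInner u v).re ≤ ‖fockInner u v‖ := Complex.re_le_norm _
  have hre' : (fockInner v u).re ≤ ‖fockInner u v‖ := by
    rw [← conj_fockInner, Complex.conj_re]; exact Complex.re_le_norm _
  rw [fockInner_add_left, fockInner_add_right, fockInner_add_right]
  simp only [Complex.add_re]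
  linarith

omit [Fintype ι] [DecidableEq ι] in
/-- `‖cA‖² = |c|²‖A‖²` on real parts. [folklore] -/
theorem fockInner_C_mul_self_re (c : ℂ) (A : MvPolynomial ι ℂ) :
    (fockInner (C c * A) (C c * A)).re = ‖c‖ ^ 2 * (fockInner A A).re := by
  rw [fockInner_C_mul_self, Complex.re_ofReal_mul]

omit [Fintype ι] in
/-- `‖X_kX_lξ‖² ≤ 3‖ξ‖² + ‖a_lξ‖² + 2‖a_kξ‖² + 2‖a_la_kξ‖²`. [folklore] -/
theorem fockInner_X_mul_X_mul_self_re_le (k l : ι) (ξ : MvPolynomial ι ℂ) :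
    (fockInner (X k * (X l * ξ)) (X k * (X l * ξ))).re ≤
      3 * (fockInner ξ ξ).re + (fockInner (pderiv l ξ) (pderiv l ξ)).re +
        2 * (fockInner (pderiv k ξ) (pderiv k ξ)).re +
        2 * (fockInner (pderiv l (pderiv k ξ)) (pderiv l (pderiv k ξ))).re := by
  rw [fockInner_X_mul_self, Complex.add_re, fockInner_X_mul_self, Complex.add_re, pderiv_X_mul]
  have h := fockInner_add_self_re_le (X l * pderiv k ξ) (if k = l then ξ else 0)
  rw [fockInner_X_mul_self, Complex.add_re] at h
  have hite : (fockInner (if k = l then ξ else (0 : MvPolynomial ι ℂ)) (if k = l then ξ else 0)).re ≤ (fockInner ξ ξ).re := by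
    split_ifs
    · exact le_rfl
    · rw [fockInner_zero_left, Complex.zero_re]; exact fockInner_self_re_nonneg _
  have h0 := fockInner_self_re_nonneg (pderiv k ξ)
  linarith

section Moments

/-- **`∑_q‖A_qξ‖² = (N₀ + ∑σ²)‖ξ‖² + ∑(γ²+σ²)‖a_qξ‖²`** for a graded `ξ` with `a_zξ = 0`: the
expected particle number of `W(N₀)T_νξ/‖ξ‖` is `N₀ + ‖σ‖² + ⟨T*𝒩-excess⟩ ≥ N₀ + ‖σ‖²`.
[cite: BastiCenatiempoSchlein2021, Prop. 2.4, (2.14) ("`⟨Ψ_N, 𝒩Ψ_N⟩ ≥ N`")] -/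
theorem sum_fockInner_conjAn_self_re_eq {M : Type*} [AddCommGroup M] {g : M} (h2 : 2 • g ≠ 0)
    (hσ : Function.Involutive σ) (hP : ∀ p ∈ P, σ p ∉ P) (hσz : σ z = z) (hN₀ : 0 ≤ N₀)
    {ξ : MvPolynomial ι ℂ} {m : M} (hξ : IsWeightedHomogeneous (fun _ : ι => g) ξ m) (hξz : pderiv z ξ = 0) :
    ∑ q, (fockInner (conjAn z σ P N₀ t q ξ) (conjAn z σ P N₀ t q ξ)).re =
      (N₀ + ∑ q, bogSigma σ P t q ^ 2) * (fockInner ξ ξ).re +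
        ∑ q, (bogGamma σ P t q ^ 2 + bogSigma σ P t q ^ 2) * (fockInner (pderiv q ξ) (pderiv q ξ)).re := by
  -- `A_q ξ = B_q ξ` off the condensate, `A_z ξ = √N₀ ξ`
  have hpt : ∀ q, (fockInner (conjAn z σ P N₀ t q ξ) (conjAn z σ P N₀ t q ξ)).re =
      (fockInner (bogAn σ P t q ξ) (bogAn σ P t q ξ)).re + (if q = z then N₀ * (fockInner ξ ξ).re else 0) := by
    intro q
    by_cases hq : q = z
    · subst hq
      rw [conjAn_eq, condShift_z, bogAn_z_of hP hσz hξz, zero_add, if_pos rfl, fockInner_C_mul_self_re,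
        fockInner_zero_left, Complex.zero_re, zero_add, Complex.norm_real, Real.norm_eq_abs, sq_abs,
        Real.sq_sqrt hN₀]
    · rw [conjAn_eq, condShift_of_ne hq, if_neg hq, add_zero]
      simp
  simp only [hpt, Finset.sum_add_distrib, Finset.sum_ite_eq', Finset.mem_univ, if_true]
  have hkin := sum_mul_fockInner_bogAn_self_re_of_graded (t := t) hσ hP (fun _ => (1 : ℝ)) (fun _ => rfl) hξ
    (fun p h => absurd h (by
      intro h'
      apply h2
      rw [two_nsmul]; exact h'))
  simp only [one_mul] at hkin
  rw [hkin]
  ring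

/-- The `U`-block summed: `∑_{p,q} σ_p²σ_q² ‖X_{σp}X_{σq}ξ‖² ≤ 3S²‖ξ‖² + 3Ss₀²M₁ + 2s₀⁴M₂`. [folklore] -/
theorem sum_sum_UU_le (hσ : Function.Involutive σ) {s₀ : ℝ} (hs₀ : ∀ p, |bogSigma σ P t p| ≤ s₀) (ξ : MvPolynomial ι ℂ) :
    ∑ q, ∑ p, (bogSigma σ P t p * bogSigma σ P t q) ^ 2 *
        (fockInner (X (σ p) * (X (σ q) * ξ)) (X (σ p) * (X (σ q) * ξ))).re ≤
      3 * (∑ q, bogSigma σ P t q ^ 2) ^ 2 * (fockInner ξ ξ).re +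
        3 * (∑ q, bogSigma σ P t q ^ 2) * s₀ ^ 2 * ∑ q, (fockInner (pderiv q ξ) (pderiv q ξ)).re +
        2 * s₀ ^ 4 * ∑ x, ∑ y, (fockInner (pderiv y (pderiv x ξ)) (pderiv y (pderiv x ξ))).re := by
  set sg := bogSigma σ P t with hsg
  set S := ∑ q, sg q ^ 2 with hS
  set n0 := (fockInner ξ ξ).re
  set n1 : ι → ℝ := fun k => (fockInner (pderiv k ξ) (pderiv k ξ)).re with hn1
  set n2 : ι → ι → ℝ := fun k l => (fockInner (pderiv l (pderiv k ξ)) (pderiv l (pderiv k ξ))).re with hn2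
  have hn00 : 0 ≤ n0 := fockInner_self_re_nonneg _
  have hn10 : ∀ k, 0 ≤ n1 k := fun k => fockInner_self_re_nonneg _
  have hn20 : ∀ k l, 0 ≤ n2 k l := fun k l => fockInner_self_re_nonneg _
  have hsq : ∀ p, sg p ^ 2 ≤ s₀ ^ 2 := fun p => by rw [← sq_abs]; exact pow_le_pow_left₀ (abs_nonneg _) (hs₀ p) 2
  -- termwise
  have hpt : ∀ q p, (sg p * sg q) ^ 2 * (fockInner (X (σ p) * (X (σ q) * ξ)) (X (σ p) * (X (σ q) * ξ))).re ≤
      3 * (sg p ^ 2 * sg q ^ 2) * n0 + sg p ^ 2 * (s₀ ^ 2 * n1 (σ q)) + 2 * sg q ^ 2 * (s₀ ^ 2 * n1 (σ p)) +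
        2 * s₀ ^ 4 * n2 (σ p) (σ q) := by
    intro q p
    have h := fockInner_X_mul_X_mul_self_re_le (σ p) (σ q) ξ
    have hcoef : 0 ≤ (sg p * sg q) ^ 2 := sq_nonneg _
    calc (sg p * sg q) ^ 2 * (fockInner (X (σ p) * (X (σ q) * ξ)) (X (σ p) * (X (σ q) * ξ))).re
        ≤ (sg p * sg q) ^ 2 * (3 * n0 + n1 (σ q) + 2 * n1 (σ p) + 2 * n2 (σ p) (σ q)) :=
          mul_le_mul_of_nonneg_left h hcoef
      _ = 3 * (sg p ^ 2 * sg q ^ 2) * n0 + sg p ^ 2 * (sg q ^ 2 * n1 (σ q)) + 2 * sg q ^ 2 * (sg p ^ 2 * n1 (σ p)) +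
          2 * (sg p ^ 2 * sg q ^ 2) * n2 (σ p) (σ q) := by ring
      _ ≤ _ := by
          have h1 : sg q ^ 2 * n1 (σ q) ≤ s₀ ^ 2 * n1 (σ q) := mul_le_mul_of_nonneg_right (hsq q) (hn10 _)
          have h2 : sg p ^ 2 * n1 (σ p) ≤ s₀ ^ 2 * n1 (σ p) := mul_le_mul_of_nonneg_right (hsq p) (hn10 _)
          have h3 : sg p ^ 2 * sg q ^ 2 ≤ s₀ ^ 2 * s₀ ^ 2 :=
            mul_le_mul (hsq p) (hsq q) (sq_nonneg _) (sq_nonneg _)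
          have h3' : sg p ^ 2 * sg q ^ 2 * n2 (σ p) (σ q) ≤ s₀ ^ 4 * n2 (σ p) (σ q) := by
            rw [show s₀ ^ 4 = s₀ ^ 2 * s₀ ^ 2 by ring]; exact mul_le_mul_of_nonneg_right h3 (hn20 _ _)
          nlinarith [h1, h2, h3', sq_nonneg (sg p), sq_nonneg (sg q)]
  -- sum
  calc _ ≤ ∑ q, ∑ p, (3 * (sg p ^ 2 * sg q ^ 2) * n0 + sg p ^ 2 * (s₀ ^ 2 * n1 (σ q)) + 2 * sg q ^ 2 * (s₀ ^ 2 * n1 (σ p)) +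
          2 * s₀ ^ 4 * n2 (σ p) (σ q)) := Finset.sum_le_sum fun q _ => Finset.sum_le_sum fun p _ => hpt q p
    _ = 3 * S ^ 2 * n0 + S * (s₀ ^ 2 * ∑ q, n1 (σ q)) + 2 * S * (s₀ ^ 2 * ∑ p, n1 (σ p)) +
          2 * s₀ ^ 4 * ∑ q, ∑ p, n2 (σ p) (σ q) := by
        have e1 : ∑ q, ∑ p, 3 * (sg p ^ 2 * sg q ^ 2) * n0 = 3 * S ^ 2 * n0 := by
          rw [hS, sq, Finset.sum_mul_sum, Finset.mul_sum, Finset.sum_mul, Finset.sum_comm]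
          refine Finset.sum_congr rfl fun q _ => ?_
          rw [Finset.mul_sum, Finset.sum_mul]
        have e2 : ∑ q, ∑ p, sg p ^ 2 * (s₀ ^ 2 * n1 (σ q)) = S * (s₀ ^ 2 * ∑ q, n1 (σ q)) := by
          rw [hS, Finset.mul_sum, Finset.sum_mul_sum, Finset.sum_comm]
        have e3 : ∑ q, ∑ p, 2 * sg q ^ 2 * (s₀ ^ 2 * n1 (σ p)) = 2 * S * (s₀ ^ 2 * ∑ p, n1 (σ p)) := by
          rw [hS, Finset.mul_sum, Finset.mul_sum, Finset.sum_mul_sum]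
        have e4 : ∑ q, ∑ p, 2 * s₀ ^ 4 * n2 (σ p) (σ q) = 2 * s₀ ^ 4 * ∑ q, ∑ p, n2 (σ p) (σ q) := by
          rw [Finset.mul_sum]; exact Finset.sum_congr rfl fun q _ => by rw [Finset.mul_sum]
        rw [← e1, ← e2, ← e3, ← e4]
        simp only [← Finset.sum_add_distrib]
    _ = _ := by
        rw [sum_comp_involutive hσ n1]
        have h2 : ∑ q, ∑ p, n2 (σ p) (σ q) = ∑ x, ∑ y, n2 x y := by
          rw [sum_comp_involutive hσ (fun q => ∑ p, n2 (σ p) q), Finset.sum_comm]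
          exact sum_comp_involutive hσ (fun p => ∑ y, n2 p y)
        rw [h2]
        ring

omit [Fintype ι] in
/-- The `Z`-block of `B_pB_qξ` bounded:
`‖γ_pσ_q∂_p(X_{σq}ξ) + σ_pγ_qX_{σp}∂_qξ‖² ≤ 4γ_p²σ_q²(‖a_pξ‖² + ‖a_{σq}a_pξ‖² + [p=σq]‖ξ‖²) + 2σ_p²γ_q²(‖a_qξ‖² + ‖a_{σp}a_qξ‖²)`.
[folklore] -/
theorem fockInner_Z_self_re_le (p q : ι) (ξ : MvPolynomial ι ℂ) :
    (fockInner (C ((bogGamma σ P t p * bogSigma σ P t q : ℝ) : ℂ) * pderiv p (X (σ q) * ξ) +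
        C ((bogSigma σ P t p * bogGamma σ P t q : ℝ) : ℂ) * (X (σ p) * pderiv q ξ))
      (C ((bogGamma σ P t p * bogSigma σ P t q : ℝ) : ℂ) * pderiv p (X (σ q) * ξ) +
        C ((bogSigma σ P t p * bogGamma σ P t q : ℝ) : ℂ) * (X (σ p) * pderiv q ξ))).re ≤
      4 * (bogGamma σ P t p * bogSigma σ P t q) ^ 2 *
          ((fockInner (pderiv p ξ) (pderiv p ξ)).re + (fockInner (pderiv (σ q) (pderiv p ξ)) (pderiv (σ q) (pderiv p ξ))).re +
            (if p = σ q then (fockInner ξ ξ).re else 0)) +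
        2 * (bogSigma σ P t p * bogGamma σ P t q) ^ 2 *
          ((fockInner (pderiv q ξ) (pderiv q ξ)).re + (fockInner (pderiv (σ p) (pderiv q ξ)) (pderiv (σ p) (pderiv q ξ))).re) := by
  have h := fockInner_add_self_re_le (C ((bogGamma σ P t p * bogSigma σ P t q : ℝ) : ℂ) * pderiv p (X (σ q) * ξ))
    (C ((bogSigma σ P t p * bogGamma σ P t q : ℝ) : ℂ) * (X (σ p) * pderiv q ξ))
  rw [fockInner_C_mul_self_re, fockInner_C_mul_self_re, Complex.norm_real, Complex.norm_real, Real.norm_eq_abs,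
    Real.norm_eq_abs, sq_abs, sq_abs, fockInner_X_mul_self, Complex.add_re] at h
  -- `∂_p(X_{σq}ξ) = X_{σq}∂_pξ + [p=σq]ξ`
  have h1 : (fockInner (pderiv p (X (σ q) * ξ)) (pderiv p (X (σ q) * ξ))).re ≤
      2 * ((fockInner (pderiv p ξ) (pderiv p ξ)).re + (fockInner (pderiv (σ q) (pderiv p ξ)) (pderiv (σ q) (pderiv p ξ))).re) +
        2 * (if p = σ q then (fockInner ξ ξ).re else 0) := by
    rw [pderiv_X_mul]
    have h' := fockInner_add_self_re_le (X (σ q) * pderiv p ξ) (if p = σ q then ξ else 0)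
    rw [fockInner_X_mul_self, Complex.add_re] at h'
    have hite : (fockInner (if p = σ q then ξ else (0 : MvPolynomial ι ℂ)) (if p = σ q then ξ else 0)).re =
        (if p = σ q then (fockInner ξ ξ).re else 0) := by
      split_ifs
      · rfl
      · rw [fockInner_zero_left, Complex.zero_re]
    rw [hite] at h'
    exact h'
  have hc1 : 0 ≤ (bogGamma σ P t p * bogSigma σ P t q) ^ 2 := sq_nonneg _
  have hc2 : 0 ≤ (bogSigma σ P t p * bogGamma σ P t q) ^ 2 := sq_nonneg _
  nlinarith [mul_le_mul_of_nonneg_left h1 hc1, h]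

/-- The `Z`-blocks summed: `∑_{p,q}‖Z_{pq}ξ‖² ≤ 6g₁²SM₁ + 6g₁²s₀²M₂ + 4g₁²S‖ξ‖²`. [folklore] -/
theorem sum_sum_ZZ_le (hσ : Function.Involutive σ) {s₀ g₁ : ℝ} (hs₀ : ∀ p, |bogSigma σ P t p| ≤ s₀)
    (hg₁ : ∀ p, |bogGamma σ P t p| ≤ g₁) (ξ : MvPolynomial ι ℂ) :
    ∑ q, ∑ p, (fockInner (C ((bogGamma σ P t p * bogSigma σ P t q : ℝ) : ℂ) * pderiv p (X (σ q) * ξ) +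
        C ((bogSigma σ P t p * bogGamma σ P t q : ℝ) : ℂ) * (X (σ p) * pderiv q ξ))
      (C ((bogGamma σ P t p * bogSigma σ P t q : ℝ) : ℂ) * pderiv p (X (σ q) * ξ) +
        C ((bogSigma σ P t p * bogGamma σ P t q : ℝ) : ℂ) * (X (σ p) * pderiv q ξ))).re ≤
      6 * g₁ ^ 2 * (∑ q, bogSigma σ P t q ^ 2) * ∑ q, (fockInner (pderiv q ξ) (pderiv q ξ)).re +
        6 * g₁ ^ 2 * s₀ ^ 2 * ∑ x, ∑ y, (fockInner (pderiv y (pderiv x ξ)) (pderiv y (pderiv x ξ))).re +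
        4 * g₁ ^ 2 * (∑ q, bogSigma σ P t q ^ 2) * (fockInner ξ ξ).re := by
  set gm := bogGamma σ P t with hgm
  set sg := bogSigma σ P t with hsg
  set S := ∑ q, sg q ^ 2 with hS
  set n0 := (fockInner ξ ξ).re with hn0
  set n1 : ι → ℝ := fun k => (fockInner (pderiv k ξ) (pderiv k ξ)).re with hn1
  set n2 : ι → ι → ℝ := fun k l => (fockInner (pderiv l (pderiv k ξ)) (pderiv l (pderiv k ξ))).re with hn2
  have hn00 : 0 ≤ n0 := fockInner_self_re_nonneg _
  have hn10 : ∀ k, 0 ≤ n1 k := fun k => fockInner_self_re_nonneg _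
  have hn20 : ∀ k l, 0 ≤ n2 k l := fun k l => fockInner_self_re_nonneg _
  have hsq : ∀ p, sg p ^ 2 ≤ s₀ ^ 2 := fun p => by rw [← sq_abs]; exact pow_le_pow_left₀ (abs_nonneg _) (hs₀ p) 2
  have hgq : ∀ p, gm p ^ 2 ≤ g₁ ^ 2 := fun p => by rw [← sq_abs]; exact pow_le_pow_left₀ (abs_nonneg _) (hg₁ p) 2
  -- termwise
  have hpt : ∀ q p, (fockInner (C ((gm p * sg q : ℝ) : ℂ) * pderiv p (X (σ q) * ξ) + C ((sg p * gm q : ℝ) : ℂ) * (X (σ p) * pderiv q ξ))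
      (C ((gm p * sg q : ℝ) : ℂ) * pderiv p (X (σ q) * ξ) + C ((sg p * gm q : ℝ) : ℂ) * (X (σ p) * pderiv q ξ))).re ≤
      4 * (g₁ ^ 2 * sg q ^ 2) * n1 p + 4 * (g₁ ^ 2 * s₀ ^ 2) * n2 p (σ q) + 4 * (g₁ ^ 2 * sg q ^ 2) * (if p = σ q then n0 else 0) +
        2 * (sg p ^ 2 * g₁ ^ 2) * n1 q + 2 * (s₀ ^ 2 * g₁ ^ 2) * n2 q (σ p) := by
    intro q p
    have h := fockInner_Z_self_re_le (σ := σ) (P := P) (t := t) p q ξ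
    simp only [← hgm, ← hsg] at h
    have h1 : (gm p * sg q) ^ 2 ≤ g₁ ^ 2 * sg q ^ 2 := by rw [mul_pow]; exact mul_le_mul_of_nonneg_right (hgq p) (sq_nonneg _)
    have h2 : (sg p * gm q) ^ 2 ≤ sg p ^ 2 * g₁ ^ 2 := by rw [mul_pow]; exact mul_le_mul_of_nonneg_left (hgq q) (sq_nonneg _)
    have h3 : g₁ ^ 2 * sg q ^ 2 ≤ g₁ ^ 2 * s₀ ^ 2 := mul_le_mul_of_nonneg_left (hsq q) (sq_nonneg _)
    have h4 : sg p ^ 2 * g₁ ^ 2 ≤ s₀ ^ 2 * g₁ ^ 2 := mul_le_mul_of_nonneg_right (hsq p) (sq_nonneg _)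
    have hi : 0 ≤ (if p = σ q then n0 else 0) := by split_ifs <;> [exact hn00; exact le_rfl]
    have := hn10 p; have := hn10 q; have := hn20 p (σ q); have := hn20 q (σ p)
    nlinarith [mul_le_mul_of_nonneg_right h1 (add_nonneg (add_nonneg (hn10 p) (hn20 p (σ q))) hi),
      mul_le_mul_of_nonneg_right h2 (add_nonneg (hn10 q) (hn20 q (σ p))),
      mul_le_mul_of_nonneg_right h3 (hn20 p (σ q)), mul_le_mul_of_nonneg_right h4 (hn20 q (σ p))]
  -- sum
  have eA : ∑ q, ∑ p, 4 * (g₁ ^ 2 * sg q ^ 2) * n1 p = 4 * g₁ ^ 2 * S * ∑ q, n1 q := by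
    rw [hS, mul_assoc, Finset.sum_mul_sum, Finset.mul_sum]
    refine Finset.sum_congr rfl fun q _ => ?_
    rw [Finset.mul_sum]
    exact Finset.sum_congr rfl fun p _ => by ring
  have eB : ∑ q, ∑ p, 4 * (g₁ ^ 2 * s₀ ^ 2) * n2 p (σ q) = 4 * g₁ ^ 2 * s₀ ^ 2 * ∑ x, ∑ y, n2 x y := by
    rw [sum_comp_involutive hσ (fun y => ∑ p, 4 * (g₁ ^ 2 * s₀ ^ 2) * n2 p y), Finset.sum_comm, Finset.mul_sum]
    refine Finset.sum_congr rfl fun x _ => ?_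
    rw [Finset.mul_sum]
    exact Finset.sum_congr rfl fun y _ => by ring
  have eC : ∑ q, ∑ p, 4 * (g₁ ^ 2 * sg q ^ 2) * (if p = σ q then n0 else 0) = 4 * g₁ ^ 2 * S * n0 := by
    simp only [mul_ite, mul_zero, Finset.sum_ite_eq', Finset.mem_univ, if_true]
    rw [hS, Finset.mul_sum, Finset.sum_mul]
    exact Finset.sum_congr rfl fun q _ => by ring
  have eD : ∑ q, ∑ p, 2 * (sg p ^ 2 * g₁ ^ 2) * n1 q = 2 * g₁ ^ 2 * S * ∑ q, n1 q := by
    rw [Finset.sum_comm, hS, mul_assoc, Finset.sum_mul_sum, Finset.mul_sum]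
    refine Finset.sum_congr rfl fun p _ => ?_
    rw [Finset.mul_sum]
    exact Finset.sum_congr rfl fun q _ => by ring
  have eE : ∑ q, ∑ p, 2 * (s₀ ^ 2 * g₁ ^ 2) * n2 q (σ p) = 2 * g₁ ^ 2 * s₀ ^ 2 * ∑ x, ∑ y, n2 x y := by
    rw [Finset.mul_sum]
    refine Finset.sum_congr rfl fun q _ => ?_
    rw [sum_comp_involutive hσ (fun y => 2 * (s₀ ^ 2 * g₁ ^ 2) * n2 q y), Finset.mul_sum]
    exact Finset.sum_congr rfl fun y _ => by ring
  calc _ ≤ ∑ q, ∑ p, (4 * (g₁ ^ 2 * sg q ^ 2) * n1 p + 4 * (g₁ ^ 2 * s₀ ^ 2) * n2 p (σ q) +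
          4 * (g₁ ^ 2 * sg q ^ 2) * (if p = σ q then n0 else 0) + 2 * (sg p ^ 2 * g₁ ^ 2) * n1 q +
          2 * (s₀ ^ 2 * g₁ ^ 2) * n2 q (σ p)) := Finset.sum_le_sum fun q _ => Finset.sum_le_sum fun p _ => hpt q p
    _ = 4 * g₁ ^ 2 * S * (∑ q, n1 q) + 4 * g₁ ^ 2 * s₀ ^ 2 * (∑ x, ∑ y, n2 x y) + 4 * g₁ ^ 2 * S * n0 +
          2 * g₁ ^ 2 * S * (∑ q, n1 q) + 2 * g₁ ^ 2 * s₀ ^ 2 * ∑ x, ∑ y, n2 x y := by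
        rw [← eA, ← eB, ← eC, ← eD, ← eE]
        simp only [← Finset.sum_add_distrib]
    _ = _ := by ring

/-- The pure Bogoliubov block summed: `∑_{p,q}‖B_pB_qξ‖² ≤ g₁⁴M₂ + (ZZ bound) + (UU bound)` for a graded
`ξ`. [folklore] -/
theorem sum_sum_fockInner_bogAn_bogAn_self_re_le {M : Type*} [AddCommGroup M] {g : M} (h2 : 2 • g ≠ 0)
    (h4 : 4 • g ≠ 0) (hσ : Function.Involutive σ) {s₀ g₁ : ℝ} (hs₀ : ∀ p, |bogSigma σ P t p| ≤ s₀)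
    (hg₁ : ∀ p, |bogGamma σ P t p| ≤ g₁) {ξ : MvPolynomial ι ℂ} {m : M} (hξ : IsWeightedHomogeneous (fun _ : ι => g) ξ m) :
    ∑ q, ∑ p, (fockInner (bogAn σ P t p (bogAn σ P t q ξ)) (bogAn σ P t p (bogAn σ P t q ξ))).re ≤
      g₁ ^ 4 * ∑ x, ∑ y, (fockInner (pderiv y (pderiv x ξ)) (pderiv y (pderiv x ξ))).re +
        (6 * g₁ ^ 2 * (∑ q, bogSigma σ P t q ^ 2) * ∑ q, (fockInner (pderiv q ξ) (pderiv q ξ)).re +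
          6 * g₁ ^ 2 * s₀ ^ 2 * ∑ x, ∑ y, (fockInner (pderiv y (pderiv x ξ)) (pderiv y (pderiv x ξ))).re +
          4 * g₁ ^ 2 * (∑ q, bogSigma σ P t q ^ 2) * (fockInner ξ ξ).re) +
        (3 * (∑ q, bogSigma σ P t q ^ 2) ^ 2 * (fockInner ξ ξ).re +
          3 * (∑ q, bogSigma σ P t q ^ 2) * s₀ ^ 2 * ∑ q, (fockInner (pderiv q ξ) (pderiv q ξ)).re +
          2 * s₀ ^ 4 * ∑ x, ∑ y, (fockInner (pderiv y (pderiv x ξ)) (pderiv y (pderiv x ξ))).re) := by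
  have hgq : ∀ p, bogGamma σ P t p ^ 2 ≤ g₁ ^ 2 := fun p => by
    rw [← sq_abs]; exact pow_le_pow_left₀ (abs_nonneg _) (hg₁ p) 2
  have hexp : ∀ q p, (fockInner (bogAn σ P t p (bogAn σ P t q ξ)) (bogAn σ P t p (bogAn σ P t q ξ))).re =
      (bogGamma σ P t p * bogGamma σ P t q * (bogGamma σ P t p * bogGamma σ P t q)) *
          (fockInner (pderiv p (pderiv q ξ)) (pderiv p (pderiv q ξ))).re +
        (fockInner (C ((bogGamma σ P t p * bogSigma σ P t q : ℝ) : ℂ) * pderiv p (X (σ q) * ξ) +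
            C ((bogSigma σ P t p * bogGamma σ P t q : ℝ) : ℂ) * (X (σ p) * pderiv q ξ))
          (C ((bogGamma σ P t p * bogSigma σ P t q : ℝ) : ℂ) * pderiv p (X (σ q) * ξ) +
            C ((bogSigma σ P t p * bogGamma σ P t q : ℝ) : ℂ) * (X (σ p) * pderiv q ξ))).re +
        (bogSigma σ P t p * bogSigma σ P t q * (bogSigma σ P t p * bogSigma σ P t q)) *
          (fockInner (X (σ p) * (X (σ q) * ξ)) (X (σ p) * (X (σ q) * ξ))).re := by
    intro q p
    rw [fockInner_bogAn_bogAn_of_graded h2 h4 hξ q p q p]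
    simp only [Complex.add_re, Complex.re_ofReal_mul]
  simp only [hexp, Finset.sum_add_distrib]
  refine add_le_add (add_le_add ?_ (sum_sum_ZZ_le hσ hs₀ hg₁ ξ)) ?_
  · calc ∑ q, ∑ p, bogGamma σ P t p * bogGamma σ P t q * (bogGamma σ P t p * bogGamma σ P t q) *
          (fockInner (pderiv p (pderiv q ξ)) (pderiv p (pderiv q ξ))).re
        ≤ ∑ q, ∑ p, g₁ ^ 4 * (fockInner (pderiv p (pderiv q ξ)) (pderiv p (pderiv q ξ))).re := by
          refine Finset.sum_le_sum fun q _ => Finset.sum_le_sum fun p _ => mul_le_mul_of_nonneg_right ?_ (fockInner_self_re_nonneg _)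
          calc bogGamma σ P t p * bogGamma σ P t q * (bogGamma σ P t p * bogGamma σ P t q)
              = bogGamma σ P t p ^ 2 * bogGamma σ P t q ^ 2 := by ring
            _ ≤ g₁ ^ 2 * g₁ ^ 2 := mul_le_mul (hgq p) (hgq q) (sq_nonneg _) (sq_nonneg _)
            _ = g₁ ^ 4 := by ring
      _ = g₁ ^ 4 * ∑ x, ∑ y, (fockInner (pderiv y (pderiv x ξ)) (pderiv y (pderiv x ξ))).re := by
          simp only [← Finset.mul_sum]
  · have h := sum_sum_UU_le (P := P) (t := t) hσ hs₀ ξ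
    calc ∑ q, ∑ p, bogSigma σ P t p * bogSigma σ P t q * (bogSigma σ P t p * bogSigma σ P t q) *
          (fockInner (X (σ p) * (X (σ q) * ξ)) (X (σ p) * (X (σ q) * ξ))).re
        = ∑ q, ∑ p, (bogSigma σ P t p * bogSigma σ P t q) ^ 2 *
          (fockInner (X (σ p) * (X (σ q) * ξ)) (X (σ p) * (X (σ q) * ξ))).re :=
          Finset.sum_congr rfl fun q _ => Finset.sum_congr rfl fun p _ => by ring
      _ ≤ _ := h

/-- The reduction of `∑_{p,q}‖A_pA_qξ‖²` to the Bogoliubov words (`a_zξ = 0`):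
`≤ N₀∑_p‖A_pξ‖² + N₀∑_q‖B_qξ‖² + ∑_{p,q}‖B_pB_qξ‖²`. [folklore] -/
theorem sum_sum_fockInner_conjAn_conjAn_self_re_le_words (hσ : Function.Involutive σ) (hP : ∀ p ∈ P, σ p ∉ P)
    (hσz : σ z = z) (hN₀ : 0 ≤ N₀) {ξ : MvPolynomial ι ℂ} (hξz : pderiv z ξ = 0) :
    ∑ q, ∑ p, (fockInner (conjAn z σ P N₀ t p (conjAn z σ P N₀ t q ξ)) (conjAn z σ P N₀ t p (conjAn z σ P N₀ t q ξ))).re ≤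
      N₀ * ∑ p, (fockInner (conjAn z σ P N₀ t p ξ) (conjAn z σ P N₀ t p ξ)).re +
      (N₀ * ∑ q, (fockInner (bogAn σ P t q ξ) (bogAn σ P t q ξ)).re +
        ∑ q, ∑ p, (fockInner (bogAn σ P t p (bogAn σ P t q ξ)) (bogAn σ P t p (bogAn σ P t q ξ))).re) := by
  classical
  have hAz : conjAn z σ P N₀ t z ξ = C ((Real.sqrt N₀ : ℝ) : ℂ) * ξ := by
    rw [conjAn_eq, condShift_z, bogAn_z_of hP hσz hξz, zero_add]
  have hAq : ∀ {q}, q ≠ z → conjAn z σ P N₀ t q ξ = bogAn σ P t q ξ := by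
    intro q hq; rw [conjAn_eq, condShift_of_ne hq]; simp
  have hlin : ∀ (p : ι) (c : ℂ) (u : MvPolynomial ι ℂ), conjAn z σ P N₀ t p (C c * u) = C c * conjAn z σ P N₀ t p u := by
    intro p c u; rw [← smul_eq_C_mul, ← smul_eq_C_mul, map_smul]
  have hval : ∀ q p, (fockInner (conjAn z σ P N₀ t p (conjAn z σ P N₀ t q ξ)) (conjAn z σ P N₀ t p (conjAn z σ P N₀ t q ξ))).re =
      if q = z then N₀ * (fockInner (conjAn z σ P N₀ t p ξ) (conjAn z σ P N₀ t p ξ)).re else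
        (if p = z then N₀ * (fockInner (bogAn σ P t q ξ) (bogAn σ P t q ξ)).re else
          (fockInner (bogAn σ P t p (bogAn σ P t q ξ)) (bogAn σ P t p (bogAn σ P t q ξ))).re) := by
    intro q p
    by_cases hq : q = z
    · subst hq
      rw [if_pos rfl, hAz, hlin, fockInner_C_mul_self_re, Complex.norm_real, Real.norm_eq_abs, sq_abs, Real.sq_sqrt hN₀]
    · rw [if_neg hq, hAq hq]
      by_cases hp : p = z
      · subst hp
        rw [if_pos rfl, conjAn_eq, condShift_z, bogAn_z hP hσz, pderiv_z_bogAn hσ hσz hq, hξz, map_zero, zero_add,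
          fockInner_C_mul_self_re, Complex.norm_real, Real.norm_eq_abs, sq_abs, Real.sq_sqrt hN₀]
      · rw [if_neg hp, conjAn_eq, condShift_of_ne hp]
        simp
  simp only [hval]
  rw [← Finset.add_sum_erase _ _ (Finset.mem_univ z)]
  simp only [if_true]
  rw [← Finset.mul_sum]
  refine add_le_add le_rfl ?_
  have hrow : ∀ q ∈ Finset.univ.erase z, (∑ p, (if q = z then N₀ * (fockInner (conjAn z σ P N₀ t p ξ) (conjAn z σ P N₀ t p ξ)).re else
      (if p = z then N₀ * (fockInner (bogAn σ P t q ξ) (bogAn σ P t q ξ)).re else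
        (fockInner (bogAn σ P t p (bogAn σ P t q ξ)) (bogAn σ P t p (bogAn σ P t q ξ))).re))) ≤
      N₀ * (fockInner (bogAn σ P t q ξ) (bogAn σ P t q ξ)).re +
        ∑ p, (fockInner (bogAn σ P t p (bogAn σ P t q ξ)) (bogAn σ P t p (bogAn σ P t q ξ))).re := by
    intro q hq
    have hqz : q ≠ z := Finset.ne_of_mem_erase hq
    simp only [if_neg hqz]
    rw [← Finset.add_sum_erase _ _ (Finset.mem_univ z), if_pos rfl,
      ← Finset.add_sum_erase _ (fun p => (fockInner (bogAn σ P t p (bogAn σ P t q ξ)) (bogAn σ P t p (bogAn σ P t q ξ))).re)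
        (Finset.mem_univ z)]
    have h0 : 0 ≤ (fockInner (bogAn σ P t z (bogAn σ P t q ξ)) (bogAn σ P t z (bogAn σ P t q ξ))).re :=
      fockInner_self_re_nonneg _
    have hrest : ∑ p ∈ Finset.univ.erase z, (if p = z then N₀ * (fockInner (bogAn σ P t q ξ) (bogAn σ P t q ξ)).re else
        (fockInner (bogAn σ P t p (bogAn σ P t q ξ)) (bogAn σ P t p (bogAn σ P t q ξ))).re) =
        ∑ p ∈ Finset.univ.erase z, (fockInner (bogAn σ P t p (bogAn σ P t q ξ)) (bogAn σ P t p (bogAn σ P t q ξ))).re :=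
      Finset.sum_congr rfl fun p hp => if_neg (Finset.ne_of_mem_erase hp)
    rw [hrest]
    linarith
  calc _ ≤ ∑ q ∈ Finset.univ.erase z, (N₀ * (fockInner (bogAn σ P t q ξ) (bogAn σ P t q ξ)).re +
        ∑ p, (fockInner (bogAn σ P t p (bogAn σ P t q ξ)) (bogAn σ P t p (bogAn σ P t q ξ))).re) :=
        Finset.sum_le_sum hrow
    _ ≤ ∑ q, (N₀ * (fockInner (bogAn σ P t q ξ) (bogAn σ P t q ξ)).re +
        ∑ p, (fockInner (bogAn σ P t p (bogAn σ P t q ξ)) (bogAn σ P t p (bogAn σ P t q ξ))).re) := by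
        refine Finset.sum_le_univ_sum_of_nonneg fun q => add_nonneg (mul_nonneg hN₀ (fockInner_self_re_nonneg _))
          (Finset.sum_nonneg fun p _ => fockInner_self_re_nonneg _)
    _ = _ := by rw [Finset.sum_add_distrib, ← Finset.mul_sum]

/-- **`∑_{p,q}‖A_pA_qξ‖²` bounded polynomially** (the crude `⟨𝒩²⟩ ≤ CN²`): with `S = ∑σ²`,
`|σ| ≤ s₀`, `|γ| ≤ g₁`, `M₁ = ∑‖a_qξ‖²`, `M₂ = ∑‖a_pa_qξ‖²`,
`∑_{p,q}‖A_pA_qξ‖² ≤ N₀(N₀+2S)‖ξ‖² + 2N₀(g₁²+s₀²)M₁ + g₁⁴M₂ + 6g₁²SM₁ + 6g₁²s₀²M₂ + 4g₁²S‖ξ‖² + 3S²‖ξ‖² + 3Ss₀²M₁ + 2s₀⁴M₂`.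
[cite: BastiCenatiempoSchlein2021, Prop. 2.4 ("`⟨Ψ_N, 𝒩²Ψ_N⟩ ≤ CN²`")] -/
theorem sum_sum_fockInner_conjAn_conjAn_self_re_le {M : Type*} [AddCommGroup M] {g : M} (h2 : 2 • g ≠ 0)
    (h4 : 4 • g ≠ 0) (hσ : Function.Involutive σ) (hP : ∀ p ∈ P, σ p ∉ P) (hσz : σ z = z) (hN₀ : 0 ≤ N₀)
    {s₀ g₁ : ℝ} (hs₀ : ∀ p, |bogSigma σ P t p| ≤ s₀) (hg₁ : ∀ p, |bogGamma σ P t p| ≤ g₁)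
    {ξ : MvPolynomial ι ℂ} {m : M} (hξ : IsWeightedHomogeneous (fun _ : ι => g) ξ m) (hξz : pderiv z ξ = 0) :
    ∑ q, ∑ p, (fockInner (conjAn z σ P N₀ t p (conjAn z σ P N₀ t q ξ)) (conjAn z σ P N₀ t p (conjAn z σ P N₀ t q ξ))).re ≤
      N₀ * (N₀ + 2 * ∑ q, bogSigma σ P t q ^ 2) * (fockInner ξ ξ).re +
      2 * N₀ * (g₁ ^ 2 + s₀ ^ 2) * ∑ q, (fockInner (pderiv q ξ) (pderiv q ξ)).re +
      (g₁ ^ 4 * ∑ x, ∑ y, (fockInner (pderiv y (pderiv x ξ)) (pderiv y (pderiv x ξ))).re +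
        (6 * g₁ ^ 2 * (∑ q, bogSigma σ P t q ^ 2) * ∑ q, (fockInner (pderiv q ξ) (pderiv q ξ)).re +
          6 * g₁ ^ 2 * s₀ ^ 2 * ∑ x, ∑ y, (fockInner (pderiv y (pderiv x ξ)) (pderiv y (pderiv x ξ))).re +
          4 * g₁ ^ 2 * (∑ q, bogSigma σ P t q ^ 2) * (fockInner ξ ξ).re) +
        (3 * (∑ q, bogSigma σ P t q ^ 2) ^ 2 * (fockInner ξ ξ).re +
          3 * (∑ q, bogSigma σ P t q ^ 2) * s₀ ^ 2 * ∑ q, (fockInner (pderiv q ξ) (pderiv q ξ)).re +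
          2 * s₀ ^ 4 * ∑ x, ∑ y, (fockInner (pderiv y (pderiv x ξ)) (pderiv y (pderiv x ξ))).re)) := by
  have hwords := sum_sum_fockInner_conjAn_conjAn_self_re_le_words (t := t) hσ hP hσz hN₀ hξz
  have hBB := sum_sum_fockInner_bogAn_bogAn_self_re_le (P := P) (t := t) h2 h4 hσ hs₀ hg₁ hξ
  have hA1 := sum_fockInner_conjAn_self_re_eq (t := t) h2 hσ hP hσz hN₀ hξ hξz
  have hkin := sum_mul_fockInner_bogAn_self_re_of_graded (t := t) hσ hP (fun _ => (1 : ℝ)) (fun _ => rfl) hξ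
    (fun p h => absurd h (by intro h'; apply h2; rw [two_nsmul]; exact h'))
  simp only [one_mul] at hkin
  have hsq : ∀ p, bogSigma σ P t p ^ 2 ≤ s₀ ^ 2 := fun p => by rw [← sq_abs]; exact pow_le_pow_left₀ (abs_nonneg _) (hs₀ p) 2
  have hgq : ∀ p, bogGamma σ P t p ^ 2 ≤ g₁ ^ 2 := fun p => by rw [← sq_abs]; exact pow_le_pow_left₀ (abs_nonneg _) (hg₁ p) 2
  have hT₁ : ∑ q, (bogGamma σ P t q ^ 2 + bogSigma σ P t q ^ 2) * (fockInner (pderiv q ξ) (pderiv q ξ)).re ≤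
      (g₁ ^ 2 + s₀ ^ 2) * ∑ q, (fockInner (pderiv q ξ) (pderiv q ξ)).re := by
    rw [Finset.mul_sum]
    exact Finset.sum_le_sum fun q _ => mul_le_mul_of_nonneg_right (add_le_add (hgq q) (hsq q)) (fockInner_self_re_nonneg _)
  have hT0 : 0 ≤ ∑ q, (bogGamma σ P t q ^ 2 + bogSigma σ P t q ^ 2) * (fockInner (pderiv q ξ) (pderiv q ξ)).re :=
    Finset.sum_nonneg fun q _ => mul_nonneg (add_nonneg (sq_nonneg _) (sq_nonneg _)) (fockInner_self_re_nonneg _)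
  rw [hA1, hkin] at hwords
  nlinarith [hwords, hBB, mul_le_mul_of_nonneg_left hT₁ hN₀, mul_le_mul_of_nonneg_left hT₁ hN₀]

end Moments

end Fock

end Literature.MathematicalPhysics.QuantumManyBody.BoseGas

end
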